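import Mathlib
import HarnessLib
import Literature.AlgebraicGeometry.Resolution.ResolutionOfSingularities
import Literature.AlgebraicGeometry.Resolution.AlterationsProofs
import Summits.ResolutionOfSingularities.ResolutionOfSingularities.Theses.WildQuotients

/-!
# The injective slice of `WildQuotientResolution` modulo lemma (L) (crux stmt-ResolutionOfSingularities-15640, line `Sketch`)

Support for the skeleton `Sketch` of crux `WildQuotients.WildQuotientResolution`: what the
registered glue stub `stub_birational_of_bijective` — lemma (L): over a field, a morphism of
integral schemes onto a positive-dimensional scheme of finite type which over a dense open is
finite, étale and bijective on points is birational — buys OUTSIDE the composition. Taking (L)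
as the hypothesis `hL` (the stub's registered signature, universally closed, verbatim):

* `hasResolution_of_injective_of_L` — **the injective slice of the crux**: if `q : X′ → X₁` is
  finite, surjective, INJECTIVE on points and étale over a dense open, with `X′` regular integral
  and `X₁` integral of finite type over `k`, then `X₁` has a resolution — namely `q` itself when
  `dim X₁ ≥ 1` ((L) makes it birational), and the identity when `dim X₁ ≤ 0` (`X₁` is then
  regular). This is the standing disprover's NEAR-MISS `slice_trivialGroup`
  (`Cruxes/WildQuotientResolution/Disproof.lean` §E: "the splitting lemma is not in the library")
  closed modulo (L): (L) IS that splitting lemma.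
* `wq_of_subsingleton_of_L` — in particular the crux holds for the trivial group (`G` a
  subsingleton: fibres = orbits says `q` is injective), modulo (L).

No group theory and no quotient is used here.
-/

-- single-problem summit: the doubled namespace component `ResolutionOfSingularities` is forced
set_option linter.dupNamespace false

namespace Summit.ResolutionOfSingularities.ResolutionOfSingularities.Theorems.WildQuotientResolution.SliceInjective

open CategoryTheory AlgebraicGeometry TopologicalSpace
open Literature.AlgebraicGeometry.Resolution

/-- **The injective slice of the crux, modulo (L).** With (L) as hypothesis `hL` (registered
signature of `stub_birational_of_bijective`, verbatim): a finite surjective `q : X′ → X₁`,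
injective on points and étale over a dense open, from a regular integral `X′` onto an integral
`X₁` locally of finite type over a field, is a resolution of `X₁` as soon as `dim X₁ ≥ 1`; in
dimension `≤ 0`, `X₁` is regular. [folklore] -/
theorem hasResolution_of_injective_of_L
    (hL : ∀ (k : Type) [Field k] {Y₁ X₁ : Scheme.{0}} (f : X₁ ⟶ Spec (.of k))
      [LocallyOfFiniteType f] [IsIntegral X₁] [IsIntegral Y₁] (r : Y₁ ⟶ X₁),
      ¬ topologicalKrullDim X₁ ≤ 0 → ∀ (W : X₁.Opens), Dense (W : Set X₁) →
      ∀ [IsFinite (r ∣_ W)] [Etale (r ∣_ W)], Function.Bijective (r ∣_ W).base → IsBirational r)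
    (k : Type) [Field k] {X' X₁ : Scheme.{0}} (f : X₁ ⟶ Spec (.of k)) (q : X' ⟶ X₁)
    [LocallyOfFiniteType f] [IsIntegral X₁] [IsIntegral X'] (hreg : Scheme.IsRegular X')
    [IsFinite q] (hsurj : Function.Surjective q.base) (hinj : Function.Injective q.base)
    (hU : ∃ U : X₁.Opens, Dense (U : Set X₁) ∧ Etale (q ∣_ U)) :
    Scheme.HasResolution X₁ := by
  by_cases hdim : topologicalKrullDim X₁ ≤ 0
  · exact (Scheme.IsRegular.of_topologicalKrullDim_le_zero hdim).hasResolution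
  obtain ⟨U, hUd, hUet⟩ := hU
  haveI := hUet
  haveI : IsFinite (q ∣_ U) := MorphismProperty.of_isPullback (isPullback_morphismRestrict q U).flip
    inferInstance
  have hbij : Function.Bijective (q ∣_ U).base := by
    constructor
    · intro a b hab
      apply Subtype.ext
      apply hinj
      have := congrArg Subtype.val hab
      simpa only [morphismRestrict_base_coe] using this
    · intro u
      obtain ⟨x, hx⟩ := hsurj u.1
      refine ⟨⟨x, show q.base x ∈ U by rw [hx]; exact u.2⟩, Subtype.ext ?_⟩
      simp only [morphismRestrict_base_coe, hx]
  exact ⟨X', q, inferInstance, hL k f q hdim U hUd hbij, hreg⟩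

/-- **The crux for the trivial group, modulo (L)**: when `G` is a subsingleton, "fibres =
orbits" says that `q` is injective on points, and `hasResolution_of_injective_of_L` applies.
(The disprover's near-miss `slice_trivialGroup`, closed modulo the registered stub (L).)
[folklore] -/
theorem wq_of_subsingleton_of_L
    (hL : ∀ (k : Type) [Field k] {Y₁ X₁ : Scheme.{0}} (f : X₁ ⟶ Spec (.of k))
      [LocallyOfFiniteType f] [IsIntegral X₁] [IsIntegral Y₁] (r : Y₁ ⟶ X₁),
      ¬ topologicalKrullDim X₁ ≤ 0 → ∀ (W : X₁.Opens), Dense (W : Set X₁) →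
      ∀ [IsFinite (r ∣_ W)] [Etale (r ∣_ W)], Function.Bijective (r ∣_ W).base → IsBirational r)
    (p : ℕ) (k : Type) [Field k] [CharP k p] (X' X₁ : Scheme.{0}) (f : X₁ ⟶ Spec (.of k))
    (q : X' ⟶ X₁) (G : Type) [Group G] [Subsingleton G] (ρ : G →* Aut X')
    [LocallyOfFiniteType f] [IsIntegral X₁] [IsIntegral X'] (hreg : Scheme.IsRegular X')
    [IsFinite q] (hsurj : Function.Surjective q.base)
    (hU : ∃ U : X₁.Opens, Dense (U : Set X₁) ∧ Etale (q ∣_ U))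
    (horb : ∀ x y : X', q.base x = q.base y → ∃ g : G, (ρ g).hom.base x = y) :
    Scheme.HasResolution X₁ := by
  refine hasResolution_of_injective_of_L hL k f q hreg hsurj (fun x y hxy => ?_) hU
  obtain ⟨g, hg⟩ := horb x y hxy
  rw [Subsingleton.elim g 1, map_one] at hg
  exact hg

end Summit.ResolutionOfSingularities.ResolutionOfSingularities.Theorems.WildQuotientResolution.SliceInjective
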